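import Literature.Computability.Cryptography.LiuPassPadding
import Literature.Computability.Complexity.Randomized

/-!
# `WbwObfuscatedGluedTrees` (stmt-QuantumAdvantage-2340) — line `knowledge-of-walk-split`: TOOLKIT III, seed laws and averaging inequalities

Helper file (generic, no crux-specific content) for the line `knowledge-of-walk-split` of crux
`WbwObfuscatedGluedTrees` (route `WhiteBoxWalk`), lead prover-line-stmt-QuantumAdvantage-2340-0.

Elementary facts about the uniform average `uniformAvg n g = 2^{-n} Σ_{x ∈ {0,1}ⁿ} g x`
(`StatisticalDistance.lean`) consumed by the three stubs of the line:

* order and linearity: `uniformAvg_mono`, `uniformAvg_const_mul`, `uniformAvg_add_distrib`,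
  `uniformAvg_le_add` (termwise `a ≤ f + w` gives `avg a ≤ avg f + avg w`), `abs_uniformAvg_sub_le`
  (termwise `|f − g| ≤ δ` gives `|avg f − avg g| ≤ δ`);
* cylinders: `uniformAvg_take` (a function of the first `a` coins), and the **seed law**
  `uniformAvg_key_coins`: for a seed `s ∈ {0,1}ⁿ` split as key `k = s ↾ a` and a key-dependent number
  `j k ≤ n − a` of further coins `r = (s ⇂ a) ↾ j k`, the average of `f k r` over `s` is the iterated average
  over a uniform key and a uniform `r ∈ {0,1}^{j k}` — the law of the instances of the generators `genObf`
  (key + obfuscator coins read off the seed) and `genClear`.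
-/

set_option linter.dupNamespace false

noncomputable section

namespace Summit.QuantumAdvantage.QuantumAdvantage.Theorems.WbwObfuscatedGluedTrees.KnowledgeOfWalk

open Literature.Computability.Cryptography Literature.Computability.Complexity

namespace SeedLaw

/-- Monotonicity of the uniform average (termwise on strings of the sampled length). [folklore] -/
theorem uniformAvg_mono {m : ℕ} {f g : List Bool → ℝ} (h : ∀ x : List Bool, x.length = m → f x ≤ g x) :
    uniformAvg m f ≤ uniformAvg m g := by
  unfold uniformAvg
  exact div_le_div_of_nonneg_right (Finset.sum_le_sum fun x _ => h _ (by simp)) (by positivity)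

/-- Constants come out of the uniform average. [folklore] -/
theorem uniformAvg_const_mul (m : ℕ) (c : ℝ) (f : List Bool → ℝ) :
    uniformAvg m (fun x => c * f x) = c * uniformAvg m f := by
  unfold uniformAvg
  rw [← Finset.mul_sum, mul_div_assoc]

/-- The uniform average is additive. [folklore] -/
theorem uniformAvg_add_distrib (m : ℕ) (f g : List Bool → ℝ) :
    uniformAvg m (fun x => f x + g x) = uniformAvg m f + uniformAvg m g := by
  unfold uniformAvg
  rw [Finset.sum_add_distrib, add_div]

/-- The uniform average is subtractive. [folklore] -/
theorem uniformAvg_sub_distrib (m : ℕ) (f g : List Bool → ℝ) :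
    uniformAvg m (fun x => f x - g x) = uniformAvg m f - uniformAvg m g := by
  unfold uniformAvg
  rw [Finset.sum_sub_distrib, sub_div]

/-- **Union-bound averaging**: a termwise bound `a ≤ f + w` averages. [folklore] -/
theorem uniformAvg_le_add {m : ℕ} {a f w : List Bool → ℝ}
    (h : ∀ x : List Bool, x.length = m → a x ≤ f x + w x) :
    uniformAvg m a ≤ uniformAvg m f + uniformAvg m w := by
  rw [← uniformAvg_add_distrib]
  exact uniformAvg_mono h

/-- **Hybrid averaging**: a termwise gap bound `|f − g| ≤ δ` averages. [folklore] -/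
theorem abs_uniformAvg_sub_le {m : ℕ} {f g : List Bool → ℝ} {δ : ℝ}
    (h : ∀ x : List Bool, x.length = m → |f x - g x| ≤ δ) :
    |uniformAvg m f - uniformAvg m g| ≤ δ := by
  rw [← uniformAvg_sub_distrib]
  have h1 : uniformAvg m (fun x => f x - g x) ≤ uniformAvg m fun _ => δ :=
    uniformAvg_mono fun x hx => (le_abs_self _).trans (h x hx)
  have h2 : uniformAvg m (fun _ => -δ) ≤ uniformAvg m (fun x => f x - g x) :=
    uniformAvg_mono fun x hx => (neg_le.1 ((neg_le_abs _).trans (h x hx)))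
  rw [uniformAvg_const] at h1 h2
  exact abs_le.2 ⟨h2, h1⟩

/-- A uniform average of values in `[0, 1]` lies in `[0, 1]` (re-export for the stub files). [folklore] -/
theorem uniformAvg_mem_unit {m : ℕ} {g : List Bool → ℝ} (h0 : ∀ x, 0 ≤ g x) (h1 : ∀ x, g x ≤ 1) :
    0 ≤ uniformAvg m g ∧ uniformAvg m g ≤ 1 :=
  ⟨uniformAvg_nonneg h0, uniformAvg_le_one h1⟩

/-- **Cylinder law**: the average over `{0,1}^{a+b}` of a function of the first `a` coins is its average over
`{0,1}^a`. [folklore] -/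
theorem uniformAvg_take (a b : ℕ) (G : List Bool → ℝ) :
    uniformAvg (a + b) (fun r => G (r.take a)) = uniformAvg a G := by
  have h := uniformAvg_add a b (fun u _ => G u)
  simpa only [uniformAvg_const] using h

/-- The same with `a ≤ N` in place of `a + b`. [folklore] -/
theorem uniformAvg_take_of_le {a N : ℕ} (h : a ≤ N) (G : List Bool → ℝ) :
    uniformAvg N (fun r => G (r.take a)) = uniformAvg a G := by
  obtain ⟨b, rfl⟩ := Nat.exists_eq_add_of_le h
  exact uniformAvg_take a b G

/-- **Seed law.**  Split a uniform seed `s ∈ {0,1}ⁿ` into the key `k = s ↾ a` and, out of the tail, a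
key-dependent number `j k ≤ n − a` of coins `r = (s ⇂ a) ↾ j k`.  Then for every `f`,
`avg_{s ∈ {0,1}ⁿ} f (s ↾ a) ((s ⇂ a) ↾ j (s ↾ a)) = avg_{k ∈ {0,1}^a} avg_{r ∈ {0,1}^{j k}} f k r`:
a uniform prefix of the uniform tail is uniform, independently of the key. [folklore] -/
theorem uniformAvg_key_coins {n a : ℕ} (ha : a ≤ n) (j : List Bool → ℕ)
    (hj : ∀ k : List Bool, k.length = a → j k ≤ n - a) (f : List Bool → List Bool → ℝ) :
    uniformAvg n (fun s => f (s.take a) ((s.drop a).take (j (s.take a)))) =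
      uniformAvg a (fun k => uniformAvg (j k) (fun r => f k r)) := by
  obtain ⟨d, rfl⟩ := Nat.exists_eq_add_of_le ha
  rw [uniformAvg_add a d (fun k t => f k (t.take (j k)))]
  refine uniformAvg_congr fun k hk => ?_
  have hjk : j k ≤ d := by simpa using hj k hk
  exact uniformAvg_take_of_le hjk (f k)

/-- Seed law, one-argument form: a function of the seed that factors through `(s ↾ a, (s ⇂ a) ↾ j (s ↾ a))`.
[folklore] -/
theorem uniformAvg_eq_key_coins {n a : ℕ} (ha : a ≤ n) (j : List Bool → ℕ)
    (hj : ∀ k : List Bool, k.length = a → j k ≤ n - a) (g : List Bool → ℝ) (f : List Bool → List Bool → ℝ)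
    (hg : ∀ s : List Bool, s.length = n → g s = f (s.take a) ((s.drop a).take (j (s.take a)))) :
    uniformAvg n g = uniformAvg a (fun k => uniformAvg (j k) (fun r => f k r)) := by
  rw [← uniformAvg_key_coins ha j hj f]
  exact uniformAvg_congr hg

/-- **Conditioning on the first coin block**: the probability of an event on `{0,1}^{a+b}` is the average, over
the first `a` coins `u`, of the probability of its `u`-section. [folklore] -/
theorem uniformProb_split (a b : ℕ) (S : Set (List Bool)) :
    uniformProb (a + b) S = uniformAvg a (fun u => uniformProb b {w | u ++ w ∈ S}) := by
  classical
  have hind : ∀ (m : ℕ) (E : Set (List Bool)), uniformProb m E = uniformAvg m (fun s => if s ∈ E then 1 else 0) := by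
    intro m E
    unfold uniformProb uniformAvg
    rw [Finset.sum_boole]
  have h1 : uniformAvg (a + b) (fun s => if s ∈ S then (1 : ℝ) else 0) =
      uniformAvg (a + b) (fun s => if s.take a ++ s.drop a ∈ S then (1 : ℝ) else 0) :=
    uniformAvg_congr fun x _ => by simp only [List.take_append_drop]
  rw [hind, h1, uniformAvg_add a b (fun u w => if u ++ w ∈ S then (1 : ℝ) else 0)]
  exact uniformAvg_congr fun u _ => (hind b _).symm

/-- Polynomials with natural coefficients are monotone. [folklore] -/
theorem natPoly_eval_mono (p : Polynomial ℕ) {x y : ℕ} (h : x ≤ y) : p.eval x ≤ p.eval y := by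
  rw [Polynomial.eval_eq_sum_range, Polynomial.eval_eq_sum_range]
  exact Finset.sum_le_sum fun i _ => Nat.mul_le_mul_left _ (Nat.pow_le_pow_left h i)

end SeedLaw

/-- Registered helper stub of crux stmt-QuantumAdvantage-2340 (closed form of `SeedLaw.uniformAvg_key_coins`): the seed law. [folklore] -/
theorem toolkit_seedLaw :
    ∀ (n a : ℕ), a ≤ n → ∀ (j : List Bool → ℕ), (∀ k : List Bool, k.length = a → j k ≤ n - a) → ∀ (f : List Bool → List Bool → ℝ), uniformAvg n (fun s => f (s.take a) ((s.drop a).take (j (s.take a)))) = uniformAvg a (fun k => uniformAvg (j k) (fun r => f k r)) :=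
  fun _ _ ha j hj f => SeedLaw.uniformAvg_key_coins ha j hj f

end Summit.QuantumAdvantage.QuantumAdvantage.Theorems.WbwObfuscatedGluedTrees.KnowledgeOfWalk

end
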